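import Mathlib
import Literature.NumberTheory.LFunctions.Zhang2022.Section17Phi3minusLine
import Literature.NumberTheory.LFunctions.Zhang2022.Section17Phi3plusTermByTerm
import HarnessLib

/-!
# Zhang (2022) §17 (17.8): `Φ₃⁻(p)` summed over `Σ*_{ψ (mod p)}` — the double-sum form, the diagonal,
# and a REFINED off-diagonal estimate (near terms without the Gaussian loss, far terms negligible)

Topic `Literature/NumberTheory/LFunctions/Zhang2022` (Landau–Siegel audit tree; verdict-neutral).
Y. Zhang, *Discrete mean estimates and the Landau–Siegel zero*, arXiv:2211.02515v1 (2022)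
[Zhang2022LandauSiegel] — **an unrefereed manuscript under adjudication; nothing here asserts or
denies its Theorems 1–2.** §17 p. 98 [tex L4813]: "In a way similar to the proof of (17.3) we deduce
that `Φ₃⁻(p) = pΣ_n (b∗ν₁*)(n)ϱ*(n)/n + o(p)`" ((17.8); χ-twisted reading of record
`Typed.Section17.Eq17_8Chi`, RT16-int-1). Second file of the (17.8)χ discharge (companion of
`Section17Phi3minusLine`; twin of `Section17Phi3plusTermByTerm` for (17.3)):

* `norm_Phi3minus_sub_tsum_le` — summing the per-character term-by-term step over `Σ*_{ψ (mod p)}`: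
  `‖Φ₃⁻(p) − Σ_mΣ_{1≤n<M} ϱ*_≤(m)m^{−s₀′}·((bχ)∗ν₁*)(n)n^{s₀′−1}·e^{−𝓛₂²log²(n/m)}·X_p(n,m)‖
  ≤ #Σ*·(Σ_m|ϱ*_≤(m)|m^{−3/2})(Σ_{n<M}|((bχ)∗ν₁*)(n)|√n)e^{(1−𝓛₁²)/(4𝓛₂²)}`, `X_p(n,m) = Σ*_ψ ψ(n)ψ̄(m)`,
  `s₀′ = s₀(−t₀)`;
* `charSum_diag` — `X_p(n,n) = #Σ*_{ψ (mod p)}` for `1 ≤ n < p`;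
* **`norm_offDiagonal_near_far_le`** — a version of the tree's "trivial estimation"
  `SmoothWeight.norm_offDiagonal_le` that does NOT spend the Gaussian on the near terms: for `S ⊆ [1,N]`,
  `3N < p`, `𝓛₂² ≥ 2`, weights `|X(m,n)| ≤ 1` (`m ≠ n`, `m < p`), `≤ X₂` (`m ≥ p`):
  `‖Σ_mΣ_{n∈S,n≠m} T(m,n)X(m,n)‖ ≤ (Σ_{m<3N}|a(m)|m^{−1/2})(Σ_{n∈S}|b(n)|n^{−1/2})
  + (Σ_m|a(m)|m^{−3/2})(Σ_{n∈S}|b(n)|n^{3/2})(1+X₂)(1/3)^{𝓛₂²−2}` — the near terms `m < 3n` are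
  bounded with `e^{−𝓛₂²log²} ≤ 1`, the far terms `m ≥ 3n` by `e^{−𝓛₂²log²(m/n)} ≤ (n/m)²·3^{2−𝓛₂²}`.
  (For (17.8) the finite side runs over `n < P/T²`, where the tree's bound `(Σ|b|√n)·e^{1/(4𝓛₂²)}`
  would be of size `P^{3/2}T⁻³ ≫ p`; the refined near bound is `≪ (P/T²)𝓛^{O(1)} = o(p)`.)

UNCONDITIONAL (every modulus `D ≥ 2`); theorems only, 0 defs, 0 facts. The sizes and the assembly of
`Eq17_8Chi` are in the sequel `Section17Eq178Chi`.

## References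

* Y. Zhang, arXiv:2211.02515v1 (2022), §17 p. 98 ((17.8)), p. 96 ("By trivial estimation").
  [cite: Zhang2022LandauSiegel, §17 (17.8) p. 98]
-/
noncomputable section

open Complex Real ComplexConjugate

namespace Literature.NumberTheory.LFunctions.Zhang2022.Phi3Minus

open Literature.NumberTheory.LFunctions.Zhang2022
open Literature.NumberTheory.LFunctions.Zhang2022.Skeleton
open Literature.NumberTheory.LFunctions.Zhang2022.Typed.Section17
open scoped LSeries.notation

/-! ## §1. A refined "trivial estimation" for the off-diagonal -/

/-- `|a(m)|m^{−3/2} = ‖term a (3/2) m‖` for `m ≥ 1`. [folklore] -/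
private theorem norm_term_three_halves (a : ℕ → ℂ) {m : ℕ} (hm : m ≠ 0) :
    ‖LSeries.term a (3 / 2 : ℂ) m‖ = ‖a m‖ * (m : ℝ) ^ (-(3 / 2 : ℝ)) := by
  have hm' : (0 : ℝ) < m := Nat.cast_pos.mpr (Nat.pos_of_ne_zero hm)
  rw [LSeries.norm_term_eq, if_neg hm, Real.rpow_neg hm'.le, div_eq_mul_inv]
  norm_num

/-- `log 3 > 1` (`e < 3`). [folklore] -/
private theorem one_lt_log_three : (1 : ℝ) < Real.log 3 := by
  rw [Real.lt_log_iff_exp_lt (by norm_num : (0 : ℝ) < 3)]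
  have := Real.exp_one_lt_d9
  linarith

/-- **The far terms `m ≥ 3n`**: for `m ≥ 3n ≥ 3` and `𝓛₂² ≥ 2`,
`m^{−1/2}n^{−1/2}e^{−𝓛₂²log²(n/m)} ≤ m^{−3/2}·n^{3/2}·(1/3)^{𝓛₂²−2}`
(`e^{−𝓛₂²u²} ≤ e^{−𝓛₂²u} = (n/m)^{𝓛₂²} ≤ (n/m)²·(1/3)^{𝓛₂²−2}` for `u = log(m/n) ≥ log 3 > 1`, and
`m^{−5/2} ≤ m^{−3/2}`). [cite: Zhang2022LandauSiegel, §17 p. 96 ("By trivial estimation")] -/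
theorem far_gauss_le {L₂ : ℝ} (hL : 2 ≤ L₂ ^ 2) {m n : ℕ} (hn : n ≠ 0) (hmn : 3 * n ≤ m) :
    (m : ℝ) ^ (-(1 / 2 : ℝ)) * (n : ℝ) ^ (-(1 / 2 : ℝ)) * Real.exp (-(L₂ ^ 2 * Real.log ((n : ℝ) / m) ^ 2))
      ≤ (m : ℝ) ^ (-(3 / 2 : ℝ)) * (n : ℝ) ^ (3 / 2 : ℝ) * (1 / 3 : ℝ) ^ (L₂ ^ 2 - 2) := by
  have hn' : (0 : ℝ) < n := Nat.cast_pos.mpr (Nat.pos_of_ne_zero hn)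
  have hm0 : m ≠ 0 := by omega
  have hm' : (0 : ℝ) < m := Nat.cast_pos.mpr (Nat.pos_of_ne_zero hm0)
  have hm1 : (1 : ℝ) ≤ m := by exact_mod_cast Nat.pos_of_ne_zero hm0
  have h3 : 3 * (n : ℝ) ≤ m := by exact_mod_cast hmn
  set r : ℝ := (n : ℝ) / m with hr
  have hr0 : 0 < r := div_pos hn' hm'
  have hr3 : r ≤ 1 / 3 := by
    rw [hr, div_le_iff₀ hm']; linarith
  -- `log r ≤ −log 3 < −1`
  have hlogr : Real.log r ≤ -1 := by
    have h1 : Real.log r ≤ Real.log (1 / 3) := Real.log_le_log hr0 hr3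
    rw [one_div, Real.log_inv] at h1
    linarith [one_lt_log_three]
  -- `e^{−L² log² r} ≤ e^{L² log r} = r^{L²}`
  have hexp : Real.exp (-(L₂ ^ 2 * Real.log r ^ 2)) ≤ r ^ (L₂ ^ 2) := by
    rw [Real.rpow_def_of_pos hr0]
    refine Real.exp_le_exp.mpr ?_
    have hsq : -Real.log r ≤ Real.log r ^ 2 := by nlinarith
    nlinarith [sq_nonneg L₂]
  -- `r^{L²} = r²·r^{L²−2} ≤ r²·(1/3)^{L²−2}`
  have hrpow : r ^ (L₂ ^ 2) ≤ r ^ 2 * (1 / 3 : ℝ) ^ (L₂ ^ 2 - 2) := by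
    have e : r ^ (L₂ ^ 2) = r ^ (2 : ℝ) * r ^ (L₂ ^ 2 - 2) := by
      rw [← Real.rpow_add hr0]; congr 1; ring
    rw [e, Real.rpow_two]
    gcongr
  -- powers of `m`, `n`
  have em : (m : ℝ) ^ (-(1 / 2 : ℝ)) * ((m : ℝ) ^ 2)⁻¹ = (m : ℝ) ^ (-(5 / 2 : ℝ)) := by
    rw [← Real.rpow_two, ← Real.rpow_neg hm'.le, ← Real.rpow_add hm']; norm_num
  have en : (n : ℝ) ^ (-(1 / 2 : ℝ)) * (n : ℝ) ^ 2 = (n : ℝ) ^ (3 / 2 : ℝ) := by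
    rw [← Real.rpow_two, ← Real.rpow_add hn']; norm_num
  have hm52 : (m : ℝ) ^ (-(5 / 2 : ℝ)) ≤ (m : ℝ) ^ (-(3 / 2 : ℝ)) :=
    Real.rpow_le_rpow_of_exponent_le hm1 (by norm_num)
  have hr2 : r ^ 2 = (n : ℝ) ^ 2 * ((m : ℝ) ^ 2)⁻¹ := by rw [hr, div_pow, div_eq_mul_inv]
  have hpos : 0 ≤ (m : ℝ) ^ (-(1 / 2 : ℝ)) * (n : ℝ) ^ (-(1 / 2 : ℝ)) := by positivity
  calc (m : ℝ) ^ (-(1 / 2 : ℝ)) * (n : ℝ) ^ (-(1 / 2 : ℝ)) * Real.exp (-(L₂ ^ 2 * Real.log r ^ 2))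
      ≤ (m : ℝ) ^ (-(1 / 2 : ℝ)) * (n : ℝ) ^ (-(1 / 2 : ℝ)) * (r ^ 2 * (1 / 3 : ℝ) ^ (L₂ ^ 2 - 2)) :=
        mul_le_mul_of_nonneg_left (hexp.trans hrpow) hpos
    _ = ((m : ℝ) ^ (-(1 / 2 : ℝ)) * ((m : ℝ) ^ 2)⁻¹) * ((n : ℝ) ^ (-(1 / 2 : ℝ)) * (n : ℝ) ^ 2) *
          (1 / 3 : ℝ) ^ (L₂ ^ 2 - 2) := by rw [hr2]; ring
    _ = (m : ℝ) ^ (-(5 / 2 : ℝ)) * (n : ℝ) ^ (3 / 2 : ℝ) * (1 / 3 : ℝ) ^ (L₂ ^ 2 - 2) := by rw [em, en]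
    _ ≤ (m : ℝ) ^ (-(3 / 2 : ℝ)) * (n : ℝ) ^ (3 / 2 : ℝ) * (1 / 3 : ℝ) ^ (L₂ ^ 2 - 2) := by
        gcongr

/-- **The terms with `m ≠ n`, for one `m` — near/far split**: `S ⊆ [1,N]`, `3N < p`, `𝓛₂² ≥ 2`,
weights with `|X(m,n)| ≤ 1` for `m ≠ n`, `m < p` and `≤ X₂` for `m ≥ p` (`X₂ ≥ 0`):
`Σ_{n∈S,n≠m}|T(m,n)X(m,n)| ≤ [m < 3N]·|a(m)|m^{−1/2}·Σ_{n∈S}|b(n)|n^{−1/2}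
  + ‖a(m)m^{−3/2}‖·(Σ_{n∈S}|b(n)|n^{3/2})·(1+X₂)(1/3)^{𝓛₂²−2}`.
[cite: Zhang2022LandauSiegel, §17 p. 96 ("By trivial estimation"), p. 98 ((17.8))] -/
theorem sum_norm_offDiagonal_near_far_le {L₂ : ℝ} (hL : 2 ≤ L₂ ^ 2) (t₀ : ℝ) (a b : ℕ → ℂ)
    {S : Finset ℕ} {N p : ℕ} (hS : ∀ n ∈ S, n ≠ 0 ∧ n ≤ N) (hNp : 3 * N < p)
    (X : ℕ → ℕ → ℂ) {X₂ : ℝ} (hX₂ : 0 ≤ X₂) (hX1 : ∀ m n, n ∈ S → m ≠ n → m < p → ‖X m n‖ ≤ 1)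
    (hX2 : ∀ m n, n ∈ S → p ≤ m → ‖X m n‖ ≤ X₂) (m : ℕ) :
    ∑ n ∈ S.filter (fun n => n ≠ m),
        ‖LSeries.term a (SmoothWeight.s0 t₀) m * (b n * (n : ℂ) ^ (SmoothWeight.s0 t₀ - 1)) *
          cexp (-(L₂ : ℂ) ^ 2 * (Real.log ((n : ℝ) / m) : ℂ) ^ 2) * X m n‖
      ≤ (if m < 3 * N then ‖a m‖ * (m : ℝ) ^ (-(1 / 2 : ℝ)) else 0) *
            (∑ n ∈ S, ‖b n‖ * (n : ℝ) ^ (-(1 / 2 : ℝ))) +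
          ‖LSeries.term a (3 / 2 : ℂ) m‖ * (∑ n ∈ S, ‖b n‖ * (n : ℝ) ^ (3 / 2 : ℝ)) *
            ((1 + X₂) * (1 / 3 : ℝ) ^ (L₂ ^ 2 - 2)) := by
  rcases eq_or_ne m 0 with rfl | hm
  · simp only [LSeries.term_zero, zero_mul, norm_zero, Finset.sum_const_zero]
    have h1 : 0 ≤ (if 0 < 3 * N then ‖a 0‖ * ((0 : ℕ) : ℝ) ^ (-(1 / 2 : ℝ)) else 0) *
        ∑ n ∈ S, ‖b n‖ * (n : ℝ) ^ (-(1 / 2 : ℝ)) := by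
      refine mul_nonneg ?_ (Finset.sum_nonneg fun _ _ => by positivity)
      split_ifs <;> positivity
    linarith
  set θ : ℝ := (1 + X₂) * (1 / 3 : ℝ) ^ (L₂ ^ 2 - 2) with hθ
  have hθ0 : 0 ≤ θ := by positivity
  set near : ℝ := if m < 3 * N then ‖a m‖ * (m : ℝ) ^ (-(1 / 2 : ℝ)) else 0 with hnear
  have hnear0 : 0 ≤ near := by rw [hnear]; split_ifs <;> positivity
  -- termwise bound: each term is ≤ its near share + its far share
  have hterm : ∀ n ∈ S.filter (fun n => n ≠ m),
      ‖LSeries.term a (SmoothWeight.s0 t₀) m * (b n * (n : ℂ) ^ (SmoothWeight.s0 t₀ - 1)) *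
          cexp (-(L₂ : ℂ) ^ 2 * (Real.log ((n : ℝ) / m) : ℂ) ^ 2) * X m n‖
        ≤ near * (‖b n‖ * (n : ℝ) ^ (-(1 / 2 : ℝ))) +
          ‖LSeries.term a (3 / 2 : ℂ) m‖ * (‖b n‖ * (n : ℝ) ^ (3 / 2 : ℝ)) * θ := by
    intro n hn
    obtain ⟨hnS, hnm⟩ := Finset.mem_filter.mp hn
    obtain ⟨hn0, hnN⟩ := hS n hnS
    rw [norm_mul, SmoothWeight.norm_term_mul_eq t₀ a b hm hn0, norm_term_three_halves a hm]
    have hab : 0 ≤ ‖a m‖ * ‖b n‖ := mul_nonneg (norm_nonneg _) (norm_nonneg _)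
    by_cases hmn : m < 3 * n
    · -- near terms: `m < 3n ≤ 3N < p`, `|X| ≤ 1`, Gaussian `≤ 1`
      have hmp : m < p := by omega
      have hm3N : m < 3 * N := by omega
      have hX := hX1 m n hnS (Ne.symm hnm) hmp
      have hG : Real.exp (-(L₂ ^ 2 * Real.log ((n : ℝ) / m) ^ 2)) ≤ 1 :=
        Real.exp_le_one_iff.mpr (by nlinarith [sq_nonneg L₂, sq_nonneg (Real.log ((n : ℝ) / m))])
      rw [hnear, if_pos hm3N]
      have hfar0 : 0 ≤ ‖a m‖ * (m : ℝ) ^ (-(3 / 2 : ℝ)) * (‖b n‖ * (n : ℝ) ^ (3 / 2 : ℝ)) * θ := by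
        positivity
      calc ‖a m‖ * (m : ℝ) ^ (-(1 / 2 : ℝ)) * (‖b n‖ * (n : ℝ) ^ (-(1 / 2 : ℝ))) *
            Real.exp (-(L₂ ^ 2 * Real.log ((n : ℝ) / m) ^ 2)) * ‖X m n‖
          ≤ ‖a m‖ * (m : ℝ) ^ (-(1 / 2 : ℝ)) * (‖b n‖ * (n : ℝ) ^ (-(1 / 2 : ℝ))) * 1 * 1 := by
            gcongr
        _ ≤ ‖a m‖ * (m : ℝ) ^ (-(1 / 2 : ℝ)) * (‖b n‖ * (n : ℝ) ^ (-(1 / 2 : ℝ))) +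
              ‖a m‖ * (m : ℝ) ^ (-(3 / 2 : ℝ)) * (‖b n‖ * (n : ℝ) ^ (3 / 2 : ℝ)) * θ := by linarith
    · -- far terms: `m ≥ 3n`, `|X| ≤ 1 + X₂`, Gaussian `≤ (n/m)²·(1/3)^{L²−2}`
      have hmn' : 3 * n ≤ m := not_lt.mp hmn
      have h1 := far_gauss_le hL hn0 hmn'
      have hX : ‖X m n‖ ≤ 1 + X₂ := by
        by_cases hmp : m < p
        · exact (hX1 m n hnS (Ne.symm hnm) hmp).trans (by linarith)
        · exact (hX2 m n hnS (not_lt.mp hmp)).trans (by linarith)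
      have hnearb : 0 ≤ near * (‖b n‖ * (n : ℝ) ^ (-(1 / 2 : ℝ))) := by positivity
      calc ‖a m‖ * (m : ℝ) ^ (-(1 / 2 : ℝ)) * (‖b n‖ * (n : ℝ) ^ (-(1 / 2 : ℝ))) *
            Real.exp (-(L₂ ^ 2 * Real.log ((n : ℝ) / m) ^ 2)) * ‖X m n‖
          = ‖a m‖ * ‖b n‖ * ((m : ℝ) ^ (-(1 / 2 : ℝ)) * (n : ℝ) ^ (-(1 / 2 : ℝ)) *
              Real.exp (-(L₂ ^ 2 * Real.log ((n : ℝ) / m) ^ 2))) * ‖X m n‖ := by ring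
        _ ≤ ‖a m‖ * ‖b n‖ * ((m : ℝ) ^ (-(3 / 2 : ℝ)) * (n : ℝ) ^ (3 / 2 : ℝ) *
              (1 / 3 : ℝ) ^ (L₂ ^ 2 - 2)) * (1 + X₂) := by gcongr
        _ = ‖a m‖ * (m : ℝ) ^ (-(3 / 2 : ℝ)) * (‖b n‖ * (n : ℝ) ^ (3 / 2 : ℝ)) * θ := by
            rw [hθ]; ring
        _ ≤ near * (‖b n‖ * (n : ℝ) ^ (-(1 / 2 : ℝ))) +
              ‖a m‖ * (m : ℝ) ^ (-(3 / 2 : ℝ)) * (‖b n‖ * (n : ℝ) ^ (3 / 2 : ℝ)) * θ := by linarith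
  calc ∑ n ∈ S.filter (fun n => n ≠ m),
        ‖LSeries.term a (SmoothWeight.s0 t₀) m * (b n * (n : ℂ) ^ (SmoothWeight.s0 t₀ - 1)) *
          cexp (-(L₂ : ℂ) ^ 2 * (Real.log ((n : ℝ) / m) : ℂ) ^ 2) * X m n‖
      ≤ ∑ n ∈ S.filter (fun n => n ≠ m),
          (near * (‖b n‖ * (n : ℝ) ^ (-(1 / 2 : ℝ))) +
            ‖LSeries.term a (3 / 2 : ℂ) m‖ * (‖b n‖ * (n : ℝ) ^ (3 / 2 : ℝ)) * θ) :=
        Finset.sum_le_sum hterm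
    _ ≤ ∑ n ∈ S, (near * (‖b n‖ * (n : ℝ) ^ (-(1 / 2 : ℝ))) +
            ‖LSeries.term a (3 / 2 : ℂ) m‖ * (‖b n‖ * (n : ℝ) ^ (3 / 2 : ℝ)) * θ) :=
        Finset.sum_le_sum_of_subset_of_nonneg (Finset.filter_subset _ _)
          (fun n _ _ => by positivity)
    _ = near * (∑ n ∈ S, ‖b n‖ * (n : ℝ) ^ (-(1 / 2 : ℝ))) +
          ‖LSeries.term a (3 / 2 : ℂ) m‖ * (∑ n ∈ S, ‖b n‖ * (n : ℝ) ^ (3 / 2 : ℝ)) * θ := by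
        rw [Finset.sum_add_distrib, Finset.mul_sum, Finset.mul_sum, Finset.sum_mul]

/-- **The off-diagonal double sum — refined bound**: with `T(m,n) = a(m)m^{−s₀}b(n)n^{s₀−1}e^{−𝓛₂²log²(n/m)}`
(the terms of `SmoothWeight.integral_LSeries_mul_sum_mul_omega`), `S ⊆ [1,N]`, `3N < p`, `𝓛₂² ≥ 2`,
weights as in `sum_norm_offDiagonal_near_far_le`, and `Σ_m|a(m)|m^{−3/2} < ∞`: the `m`-series is
summable and
`‖Σ_mΣ_{n∈S,n≠m}T(m,n)X(m,n)‖ ≤ (Σ_{m<3N}|a(m)|m^{−1/2})(Σ_{n∈S}|b(n)|n^{−1/2})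
  + (Σ_m|a(m)|m^{−3/2})(Σ_{n∈S}|b(n)|n^{3/2})(1+X₂)(1/3)^{𝓛₂²−2}`.
[cite: Zhang2022LandauSiegel, §17 (17.8) p. 98] -/
theorem norm_offDiagonal_near_far_le {L₂ : ℝ} (hL : 2 ≤ L₂ ^ 2) (t₀ : ℝ) {a : ℕ → ℂ}
    (ha : LSeriesSummable a (3 / 2 : ℂ)) (b : ℕ → ℂ) {S : Finset ℕ} {N p : ℕ}
    (hS : ∀ n ∈ S, n ≠ 0 ∧ n ≤ N) (hNp : 3 * N < p) (X : ℕ → ℕ → ℂ) {X₂ : ℝ} (hX₂ : 0 ≤ X₂)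
    (hX1 : ∀ m n, n ∈ S → m ≠ n → m < p → ‖X m n‖ ≤ 1)
    (hX2 : ∀ m n, n ∈ S → p ≤ m → ‖X m n‖ ≤ X₂) :
    Summable (fun m : ℕ => ∑ n ∈ S.filter (fun n => n ≠ m),
        LSeries.term a (SmoothWeight.s0 t₀) m * (b n * (n : ℂ) ^ (SmoothWeight.s0 t₀ - 1)) *
          cexp (-(L₂ : ℂ) ^ 2 * (Real.log ((n : ℝ) / m) : ℂ) ^ 2) * X m n) ∧
    ‖∑' m : ℕ, ∑ n ∈ S.filter (fun n => n ≠ m),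
        LSeries.term a (SmoothWeight.s0 t₀) m * (b n * (n : ℂ) ^ (SmoothWeight.s0 t₀ - 1)) *
          cexp (-(L₂ : ℂ) ^ 2 * (Real.log ((n : ℝ) / m) : ℂ) ^ 2) * X m n‖
      ≤ (∑ m ∈ Finset.range (3 * N), ‖a m‖ * (m : ℝ) ^ (-(1 / 2 : ℝ))) *
            (∑ n ∈ S, ‖b n‖ * (n : ℝ) ^ (-(1 / 2 : ℝ))) +
          (∑' m : ℕ, ‖LSeries.term a (3 / 2 : ℂ) m‖) * (∑ n ∈ S, ‖b n‖ * (n : ℝ) ^ (3 / 2 : ℝ)) *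
            ((1 + X₂) * (1 / 3 : ℝ) ^ (L₂ ^ 2 - 2)) := by
  set B₁ : ℝ := ∑ n ∈ S, ‖b n‖ * (n : ℝ) ^ (-(1 / 2 : ℝ)) with hB₁
  set B₃ : ℝ := ∑ n ∈ S, ‖b n‖ * (n : ℝ) ^ (3 / 2 : ℝ) with hB₃
  set θ : ℝ := (1 + X₂) * (1 / 3 : ℝ) ^ (L₂ ^ 2 - 2) with hθ
  set near : ℕ → ℝ := fun m => if m < 3 * N then ‖a m‖ * (m : ℝ) ^ (-(1 / 2 : ℝ)) else 0 with hnear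
  -- the majorant `g(m) = near(m)·B₁ + ‖term a (3/2) m‖·B₃·θ` is summable
  have hnear_supp : ∀ m ∉ Finset.range (3 * N), near m * B₁ = 0 := by
    intro m hm
    have : ¬ m < 3 * N := by simpa using hm
    simp [hnear, this]
  have hnear_sum : Summable fun m => near m * B₁ := summable_of_ne_finset_zero hnear_supp
  have hfar_sum : Summable fun m : ℕ => ‖LSeries.term a (3 / 2 : ℂ) m‖ * B₃ * θ :=
    ((summable_norm_iff.mpr ha).mul_right _).mul_right _
  have hmaj : Summable fun m : ℕ => near m * B₁ + ‖LSeries.term a (3 / 2 : ℂ) m‖ * B₃ * θ :=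
    hnear_sum.add hfar_sum
  have hle : ∀ m : ℕ, ‖∑ n ∈ S.filter (fun n => n ≠ m),
      LSeries.term a (SmoothWeight.s0 t₀) m * (b n * (n : ℂ) ^ (SmoothWeight.s0 t₀ - 1)) *
        cexp (-(L₂ : ℂ) ^ 2 * (Real.log ((n : ℝ) / m) : ℂ) ^ 2) * X m n‖
        ≤ near m * B₁ + ‖LSeries.term a (3 / 2 : ℂ) m‖ * B₃ * θ := fun m =>
    (norm_sum_le _ _).trans (sum_norm_offDiagonal_near_far_le hL t₀ a b hS hNp X hX₂ hX1 hX2 m)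
  have hsum := Summable.of_norm_bounded hmaj hle
  refine ⟨hsum, ?_⟩
  have htn : ∑' m, near m * B₁ = (∑ m ∈ Finset.range (3 * N), ‖a m‖ * (m : ℝ) ^ (-(1 / 2 : ℝ))) * B₁ := by
    rw [tsum_eq_sum hnear_supp, Finset.sum_mul]
    refine Finset.sum_congr rfl fun m hm => ?_
    have : m < 3 * N := by simpa using hm
    simp [hnear, this]
  calc ‖∑' m : ℕ, ∑ n ∈ S.filter (fun n => n ≠ m),
        LSeries.term a (SmoothWeight.s0 t₀) m * (b n * (n : ℂ) ^ (SmoothWeight.s0 t₀ - 1)) *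
          cexp (-(L₂ : ℂ) ^ 2 * (Real.log ((n : ℝ) / m) : ℂ) ^ 2) * X m n‖
      ≤ ∑' m : ℕ, (near m * B₁ + ‖LSeries.term a (3 / 2 : ℂ) m‖ * B₃ * θ) :=
        tsum_of_norm_bounded hmaj.hasSum hle
    _ = (∑ m ∈ Finset.range (3 * N), ‖a m‖ * (m : ℝ) ^ (-(1 / 2 : ℝ))) * B₁ +
          (∑' m : ℕ, ‖LSeries.term a (3 / 2 : ℂ) m‖) * B₃ * θ := by
        rw [hnear_sum.tsum_add hfar_sum, htn, tsum_mul_right, tsum_mul_right]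

/-! ## §2. `Φ₃⁻(p)` summed over `Σ*_{ψ (mod p)}`: the double-sum form and the diagonal weight -/

section PhiThreeMinus

variable (c' : ℝ) {D : ℕ} [NeZero D] (χ : DirichletCharacter ℂ D)

omit [NeZero D] in
/-- The sum over `Σ*_{ψ (mod p)}` of the per-character double-sum terms of `Section17Phi3minusLine` is
`ϱ*_≤(m)m^{−s₀′}·((bχ)∗ν₁*)(n)n^{s₀′−1}·e^{−𝓛₂²log²(n/m)}·X_p(n,m)`, `X_p(n,m) = Σ*_ψ ψ(n)ψ̄(m)`
(`n ≥ 1`). [cite: Zhang2022LandauSiegel, §17 (17.8) p. 98] -/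
theorem sum_chrMod_T_eq (p m n : ℕ) :
    ∑ x ∈ chrMod D p,
        LSeries.term (fun m => (trunc (D ^ 4) (nu χ) ⍟ kappa2bar c' D) m *
            conj (x.ψ (m : ZMod x.p))) (SmoothWeight.s0 (-t0 D)) m *
          ((((fun n => bcoef D n * χ (n : ZMod D)) ⍟ nuOneStar c' χ) n * x.ψ (n : ZMod x.p)) *
            (n : ℂ) ^ (SmoothWeight.s0 (-t0 D) - 1)) *
          cexp (-(ell2 D : ℂ) ^ 2 * (Real.log ((n : ℝ) / m) : ℂ) ^ 2)
      = LSeries.term (trunc (D ^ 4) (nu χ) ⍟ kappa2bar c' D) (SmoothWeight.s0 (-t0 D)) m *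
          ((((fun n => bcoef D n * χ (n : ZMod D)) ⍟ nuOneStar c' χ) n) *
            (n : ℂ) ^ (SmoothWeight.s0 (-t0 D) - 1)) *
          cexp (-(ell2 D : ℂ) ^ 2 * (Real.log ((n : ℝ) / m) : ℂ) ^ 2) *
          ∑ x ∈ chrMod D p, x.ψ (n : ZMod x.p) * conj (x.ψ (m : ZMod x.p)) := by
  rw [Finset.mul_sum]
  refine Finset.sum_congr rfl fun x _ => ?_
  rcases eq_or_ne m 0 with rfl | hm
  · simp [LSeries.term_zero]
  rw [LSeries.term_of_ne_zero hm, LSeries.term_of_ne_zero hm]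
  ring

/-- **`Φ₃⁻(p)` integrated term by term, with the error explicit** (§17 p. 98, "in a way similar to the
proof of (17.3)"): for every modulus `D ≥ 2`, every `p` and every index `M` from which `(bχ)∗ν₁*`
vanishes,
`‖Φ₃⁻(p) − Σ_mΣ_{1≤n<M} ϱ*_≤(m)m^{−s₀′}((bχ)∗ν₁*)(n)n^{s₀′−1}e^{−𝓛₂²log²(n/m)}X_p(n,m)‖
≤ #Σ*_{ψ (mod p)}·(Σ_m|ϱ*_≤(m)|m^{−3/2})·(Σ_{1≤n<M}|((bχ)∗ν₁*)(n)|√n)·e^{(1−𝓛₁²)/(4𝓛₂²)}`.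
[cite: Zhang2022LandauSiegel, §17 (17.8) p. 98] -/
theorem norm_Phi3minus_sub_tsum_le (hD : 2 ≤ D) (p : ℕ) {M : ℕ}
    (hM : ∀ n, M ≤ n → ((fun n => bcoef D n * χ (n : ZMod D)) ⍟ nuOneStar c' χ) n = 0) :
    ‖Phi3minus c' χ p - ∑' m : ℕ, ∑ n ∈ Finset.Ico 1 M,
        LSeries.term (trunc (D ^ 4) (nu χ) ⍟ kappa2bar c' D) (SmoothWeight.s0 (-t0 D)) m *
          ((((fun n => bcoef D n * χ (n : ZMod D)) ⍟ nuOneStar c' χ) n) *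
            (n : ℂ) ^ (SmoothWeight.s0 (-t0 D) - 1)) *
          cexp (-(ell2 D : ℂ) ^ 2 * (Real.log ((n : ℝ) / m) : ℂ) ^ 2) *
          ∑ x ∈ chrMod D p, x.ψ (n : ZMod x.p) * conj (x.ψ (m : ZMod x.p))‖
      ≤ (chrMod D p).card *
          (∑' m : ℕ, ‖LSeries.term (trunc (D ^ 4) (nu χ) ⍟ kappa2bar c' D) (3 / 2 : ℂ) m‖) *
          (∑ n ∈ Finset.Ico 1 M,
            ‖((fun n => bcoef D n * χ (n : ZMod D)) ⍟ nuOneStar c' χ) n‖ * Real.sqrt n) *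
          Real.exp ((1 - ell1 D ^ 2) / (4 * ell2 D ^ 2)) := by
  have hL : 0 < ell2 D := pow_pos (Real.log_pos (by exact_mod_cast hD)) _
  have hS : (0 : ℕ) ∉ Finset.Ico 1 M := by simp
  set S := Finset.Ico 1 M with hS_def
  set ρ : ℕ → ℂ := trunc (D ^ 4) (nu χ) ⍟ kappa2bar c' D with hρ
  set β : ℕ → ℂ := (fun n => bcoef D n * χ (n : ZMod D)) ⍟ nuOneStar c' χ with hβ
  set A₀ : ℝ := ∑' m : ℕ, ‖LSeries.term ρ (3 / 2 : ℂ) m‖ with hA₀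
  set B₀ : ℝ := ∑ n ∈ S, ‖β n‖ * Real.sqrt n with hB₀
  set E : ℝ := Real.exp ((1 - ell1 D ^ 2) / (4 * ell2 D ^ 2)) with hE
  -- per-character double sums
  set T : Chr D → ℕ → ℕ → ℂ := fun x m n =>
    LSeries.term (fun m => ρ m * conj (x.ψ (m : ZMod x.p))) (SmoothWeight.s0 (-t0 D)) m *
      ((β n * x.ψ (n : ZMod x.p)) * (n : ℂ) ^ (SmoothWeight.s0 (-t0 D) - 1)) *
      cexp (-(ell2 D : ℂ) ^ 2 * (Real.log ((n : ℝ) / m) : ℂ) ^ 2) with hT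
  have hρ0 : LSeriesSummable ρ (3 / 2 : ℂ) := by
    -- `ρ·ψ̄` is summable for the (principal-free) characters; for `ρ` itself use any `x`? No: prove
    -- directly: `ρ = truncν ∗ κ̄₂`, `κ̄₂ = κ₂^{(−b₁)}` summable on `σ > 1`.
    have h1 : LSeriesSummable (trunc (D ^ 4) (nu χ)) (3 / 2 : ℂ) := by
      refine summable_of_ne_finset_zero (s := Finset.range (D ^ 4 + 1)) fun n hn => ?_
      have hn' : D ^ 4 + 1 ≤ n := by simpa using hn
      have : ¬ n ≤ D ^ 4 := by omega
      rw [LSeries.term_of_ne_zero (by omega), trunc, if_neg this, zero_div]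
    have h2 : LSeriesSummable (kappa2bar c' D) (3 / 2 : ℂ) := by
      have h := MeanSquareMajorant.LSeriesSummable_kappa₂ (-(b1 c' D)) (s := (3 / 2 : ℂ)) (by norm_num)
      have e : kappa2bar c' D = fun n => MeanSquareMajorant.kappa₂ (-(b1 c' D)) n := by
        funext n; exact kappa2bar_eq_kappa₂_neg c' n
      rw [e]; exact h
    exact h1.convolution h2
  have hsumx : ∀ x : Chr D, Summable fun m : ℕ => ∑ n ∈ S, T x m n := by
    intro x
    have hax : LSeriesSummable (fun m => ρ m * conj (x.ψ (m : ZMod x.p))) (3 / 2 : ℂ) :=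
      LSeriesSummable_varrhoLe_conj c' χ x (by norm_num)
    have h := Phi3TermByTerm.summable_sum_T_mul hL (-t0 D) hax
      (fun n => β n * x.ψ (n : ZMod x.p)) hS (fun _ _ => (1 : ℂ)) (K := 1) (fun _ _ => by simp)
    refine h.congr fun m => Finset.sum_congr rfl fun n _ => ?_
    simp only [hT, mul_one]
  -- (1) Φ₃⁻(p) − Σ_x (per-character double sum) is small
  have hper : ∀ x : Chr D, ‖Lemma81.segInt (t0 D) (ell1 D) (-1)
        (fun s => kfrak3Star c' χ x s * omegaW D s) - ∑' m : ℕ, ∑ n ∈ S, T x m n‖ ≤ A₀ * B₀ * E := by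
    intro x
    refine (norm_segInt_kfrak3Star_sub_tsum_le c' χ hD x hM).trans ?_
    have hA : (∑' m : ℕ, ‖LSeries.term (fun m => ρ m * conj (x.ψ (m : ZMod x.p))) (3 / 2 : ℂ) m‖)
        ≤ A₀ := by
      refine Summable.tsum_le_tsum (fun m => ?_) (summable_norm_iff.mpr
        (LSeriesSummable_varrhoLe_conj c' χ x (by norm_num))) (summable_norm_iff.mpr hρ0)
      rw [LSeries.norm_term_eq, LSeries.norm_term_eq]
      split_ifs with hm
      · exact le_rfl
      · have : ‖ρ m * conj (x.ψ (m : ZMod x.p))‖ ≤ ‖ρ m‖ := by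
          rw [norm_mul, Complex.norm_conj]
          exact mul_le_of_le_one_right (norm_nonneg _) (x.ψ.norm_le_one _)
        exact div_le_div_of_nonneg_right this (by positivity)
    have hB : (∑ n ∈ S, ‖β n * x.ψ (n : ZMod x.p)‖ * Real.sqrt n) ≤ B₀ := by
      refine Finset.sum_le_sum fun n _ => ?_
      have : ‖β n * x.ψ (n : ZMod x.p)‖ ≤ ‖β n‖ := by
        rw [norm_mul]
        exact mul_le_of_le_one_right (norm_nonneg _) (x.ψ.norm_le_one _)
      exact mul_le_mul_of_nonneg_right this (Real.sqrt_nonneg _)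
    have hA0 : 0 ≤ ∑' m : ℕ, ‖LSeries.term (fun m => ρ m * conj (x.ψ (m : ZMod x.p))) (3 / 2 : ℂ) m‖ :=
      tsum_nonneg fun _ => norm_nonneg _
    have hB0 : 0 ≤ ∑ n ∈ S, ‖β n * x.ψ (n : ZMod x.p)‖ * Real.sqrt n :=
      Finset.sum_nonneg fun _ _ => by positivity
    have hE0 : 0 ≤ E := (Real.exp_pos _).le
    gcongr
  -- (2) the sum over x of the per-character double sums is the double sum with `X_p`
  have hswap : ∑ x ∈ chrMod D p, ∑' m : ℕ, ∑ n ∈ S, T x m n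
      = ∑' m : ℕ, ∑ n ∈ S, LSeries.term ρ (SmoothWeight.s0 (-t0 D)) m *
          (β n * (n : ℂ) ^ (SmoothWeight.s0 (-t0 D) - 1)) *
          cexp (-(ell2 D : ℂ) ^ 2 * (Real.log ((n : ℝ) / m) : ℂ) ^ 2) *
          ∑ x ∈ chrMod D p, x.ψ (n : ZMod x.p) * conj (x.ψ (m : ZMod x.p)) := by
    rw [← Summable.tsum_finsetSum (fun x _ => hsumx x)]
    refine tsum_congr fun m => ?_
    rw [Finset.sum_comm]
    refine Finset.sum_congr rfl fun n hn => ?_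
    exact sum_chrMod_T_eq c' χ p m n
  -- assemble
  rw [Phi3minus, ← hswap, ← Finset.sum_sub_distrib]
  calc ‖∑ x ∈ chrMod D p, (Lemma81.segInt (t0 D) (ell1 D) (-1)
          (fun s => kfrak3Star c' χ x s * omegaW D s) - ∑' m : ℕ, ∑ n ∈ S, T x m n)‖
      ≤ ∑ x ∈ chrMod D p, ‖Lemma81.segInt (t0 D) (ell1 D) (-1)
          (fun s => kfrak3Star c' χ x s * omegaW D s) - ∑' m : ℕ, ∑ n ∈ S, T x m n‖ := norm_sum_le _ _
    _ ≤ ∑ x ∈ chrMod D p, A₀ * B₀ * E := Finset.sum_le_sum fun x _ => hper x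
    _ = (chrMod D p).card * A₀ * B₀ * E := by rw [Finset.sum_const, nsmul_eq_mul]; ring

omit [NeZero D] in
/-- **The diagonal weight**: for `1 ≤ n < p`, `X_p(n,n) = Σ*_{ψ (mod p)} ψ(n)ψ̄(n) = #Σ*_{ψ (mod p)}`
(`p ∤ n`, `|ψ(n)| = 1`). [cite: Zhang2022LandauSiegel, §17 (17.3), (17.8)] -/
theorem charSum_diag (p : ℕ) {n : ℕ} (hn1 : 1 ≤ n) (hnp : n < p) :
    ∑ x ∈ chrMod D p, x.ψ (n : ZMod x.p) * conj (x.ψ (n : ZMod x.p)) = (chrMod D p).card := by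
  rw [Finset.card_eq_sum_ones, Nat.cast_sum]
  refine Finset.sum_congr rfl fun x hx => ?_
  have hx' : x ∈ ({x : Chr D | x.p = p} : Set (Chr D)) := mem_of_mem_finsetOf hx
  simp only [Set.mem_setOf_eq] at hx'
  have hnp' : n < x.p := hx' ▸ hnp
  have hu : IsUnit ((n : ZMod x.p)) := by
    rw [isUnit_iff_ne_zero, Ne, ZMod.natCast_eq_zero_iff]
    exact fun h => absurd (Nat.le_of_dvd (by omega) h) (not_le.mpr hnp')
  have h1 : ‖x.ψ (n : ZMod x.p)‖ = 1 := by
    have := x.ψ.unit_norm_eq_one hu.unit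
    rwa [IsUnit.unit_spec] at this
  rw [Complex.mul_conj, Complex.normSq_eq_norm_sq, h1]
  simp

omit [NeZero D] in
/-- **The weights `X_p(n,m)` off the diagonal**: `|X_p(n,m)| ≤ 1` for `m ≠ n`, `m, n < p`, and
`|X_p(n,m)| ≤ p − 1` always (orthogonality of the non-principal characters mod `p`; the tree's
`Skeleton.norm_sum_finsetOf_p_char_mul_conj_le`). [cite: Zhang2022LandauSiegel, §17 p. 96] -/
theorem norm_charSum_le {p : ℕ} (hp : p ∈ primeWindow D) (m n : ℕ) :
    ‖∑ x ∈ chrMod D p, x.ψ (n : ZMod x.p) * conj (x.ψ (m : ZMod x.p))‖ ≤ (p : ℝ) - 1 ∧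
      (m ≠ n → m < p → n < p →
        ‖∑ x ∈ chrMod D p, x.ψ (n : ZMod x.p) * conj (x.ψ (m : ZMod x.p))‖ ≤ 1) := by
  have hbd := Skeleton.norm_sum_finsetOf_p_char_mul_conj_le hp n m
  refine ⟨hbd.1, fun hmn hmp hnp => hbd.2 fun h => hmn ?_⟩
  exact ((PrimChar.natCast_eq_natCast_iff_of_lt hnp hmp).mp h).symm

end PhiThreeMinus

end Literature.NumberTheory.LFunctions.Zhang2022.Phi3Minus
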